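import Mathlib

/-!
# `NewtonUnitEquationsNewtonTauWeakOddCoverWeight` — odd covers weigh at least `r`; equality exactly for exact covers

Line `binomial-normal-form` of crux `NewtonTauWeak` (stmt-ValiantsHypothesis-5904), lead c7, wave 2, rung C7b
(sign-design kill switch), stub P4.  Labels `g j ∈ (Fin r → ZMod 2)` with supports `{i : g j i = 1}`.  For a
subfamily `J` put `n_i := #{j ∈ J : g j i = 1}`.  The `i`-th coordinate of `Σ_{j∈J} g j` is `(n_i : ZMod 2)` (every
element of `ZMod 2` is the indicator of being `1`), so the labels of `J` sum to the all-ones vector iff every `n_i` is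
odd; double counting gives `Σ_{j∈J} #{i : g j i = 1} = Σ_i n_i`.  Hence an odd cover has total weight `≥ r`, with
equality iff all `n_i = 1`, i.e. iff `J` is an exact cover; conversely an exact cover is an odd cover of weight `r`.

`stub_oddCoverWeight` is the registered stub text, verbatim.  Folklore-level; Mathlib only; no named facts, no
citations, no `def`s.
-/

-- Sub = Summit single-conjunct layout: the duplicated namespace component is mandated by the tree.
set_option linter.dupNamespace false

noncomputable section

open scoped BigOperators

namespace Summit.ValiantsHypothesis.ValiantsHypothesis.Theorems.NewtonUnitEquationsNewtonTauWeak

namespace OddCoverWeightAux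

/-- Every element of `ZMod 2` is the indicator of being equal to `1`. [folklore] -/
theorem eq_ite_eq_one : ∀ a : ZMod 2, a = if a = 1 then 1 else 0 := by
  decide

/-- The `i`-th coordinate of `Σ_{j∈J} g j` is the parity class of `n_i = #{j ∈ J : g j i = 1}`. [folklore] -/
theorem sum_apply_eq_card_filter {N r : ℕ} (g : Fin N → Fin r → ZMod 2) (J : Finset (Fin N)) (i : Fin r) :
    (∑ j ∈ J, g j) i = ((J.filter fun j => g j i = 1).card : ZMod 2) := by
  rw [Finset.sum_apply, Finset.natCast_card_filter]
  exact Finset.sum_congr rfl fun j _ => eq_ite_eq_one (g j i)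

/-- The labels of `J` sum to the all-ones vector iff every coordinate count `n_i` is odd. [folklore] -/
theorem sum_eq_one_iff_odd {N r : ℕ} (g : Fin N → Fin r → ZMod 2) (J : Finset (Fin N)) :
    (∑ j ∈ J, g j = fun _ => 1) ↔ ∀ i : Fin r, Odd (J.filter fun j => g j i = 1).card := by
  rw [funext_iff]
  refine forall_congr' fun i => ?_
  rw [sum_apply_eq_card_filter, ZMod.natCast_eq_one_iff_odd]

/-- Double counting: the total support size over `J` is the sum of the coordinate counts `n_i`. [folklore] -/
theorem sum_card_filter_comm {N r : ℕ} (g : Fin N → Fin r → ZMod 2) (J : Finset (Fin N)) :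
    ∑ j ∈ J, (Finset.univ.filter fun i : Fin r => g j i = 1).card =
      ∑ i : Fin r, (J.filter fun j => g j i = 1).card := by
  simp only [Finset.card_filter]
  exact Finset.sum_comm

/-- `r` is the sum of `r` ones. [folklore] -/
theorem sum_one_fin (r : ℕ) : ∑ _i : Fin r, (1 : ℕ) = r := by
  simp

end OddCoverWeightAux

open OddCoverWeightAux in
/-- STUB P4 — **odd covers weigh at least `r`; equality exactly for exact covers.**  Labels
`g j ∈ (Fin r → ZMod 2)` with supports `{i : g j i = 1}`; for `J` with `Σ_{j∈J} g j = 1` (all-ones) every coordinate `i` has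
`n_i := #{j ∈ J : g j i = 1}` ODD (`Σ_{j∈J} g j i = (n_i : ZMod 2)` since `g j i ∈ {0,1}`, and `(n : ZMod 2) = 1 ↔ Odd n`),
hence `n_i ≥ 1`; double counting `Σ_{j∈J} #{i : g j i = 1} = Σ_i n_i` gives `≥ r`, and `= r` iff all `n_i = 1`; conversely
all `n_i = 1` gives both the all-ones sum and the weight `r`. [folklore] -/
theorem stub_oddCoverWeight (N r : ℕ) (g : Fin N → Fin r → ZMod 2) (J : Finset (Fin N)) :
    ((∑ j ∈ J, g j = fun _ => 1) →
        r ≤ ∑ j ∈ J, (Finset.univ.filter fun i : Fin r => g j i = 1).card) ∧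
      (((∑ j ∈ J, g j = fun _ => 1) ∧
          ∑ j ∈ J, (Finset.univ.filter fun i : Fin r => g j i = 1).card = r) ↔
        ∀ i : Fin r, (J.filter fun j => g j i = 1).card = 1) := by
  have hone : ∀ {J' : Finset (Fin N)}, (∑ j ∈ J', g j = fun _ => 1) →
      ∀ i ∈ (Finset.univ : Finset (Fin r)), 1 ≤ (J'.filter fun j => g j i = 1).card :=
    fun h i _ => ((sum_eq_one_iff_odd g _).mp h i).pos
  refine ⟨fun h => ?_, ⟨fun h => fun i => ?_, fun h => ⟨?_, ?_⟩⟩⟩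
  · -- every `n_i ≥ 1`, so `Σ_i n_i ≥ r`
    calc r = (Finset.univ : Finset (Fin r)).card • 1 := by simp
      _ ≤ ∑ i : Fin r, (J.filter fun j => g j i = 1).card := Finset.card_nsmul_le_sum _ _ 1 (hone h)
      _ = _ := (sum_card_filter_comm g J).symm
  · -- `Σ_i n_i = r = Σ_i 1` with `1 ≤ n_i` termwise forces `n_i = 1`
    have hsum : ∑ _i : Fin r, (1 : ℕ) = ∑ i : Fin r, (J.filter fun j => g j i = 1).card := by
      rw [sum_one_fin, ← sum_card_filter_comm g J, h.2]
    exact ((Finset.sum_eq_sum_iff_of_le (hone h.1)).mp hsum i (Finset.mem_univ i)).symm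
  · -- all `n_i = 1` are odd: the sum is all-ones
    exact (sum_eq_one_iff_odd g J).mpr fun i => by rw [h i]; exact odd_one
  · -- all `n_i = 1`: the weight is `Σ_i 1 = r`
    rw [sum_card_filter_comm g J]
    exact (Finset.sum_congr rfl fun i _ => h i).trans (sum_one_fin r)

end Summit.ValiantsHypothesis.ValiantsHypothesis.Theorems.NewtonUnitEquationsNewtonTauWeak

end
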